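import Literature.LinearAlgebra.RootSystem.AffineWeylGroupLengthDefect
import Literature.LinearAlgebra.RootSystem.AffineWeylGroupWeakOrder
import HarnessLib

/-!
# The weak order is inclusion of separating sets; left descents = walls of `A∘` in `𝓛(w)`, right descents = walls of `wA∘` in `𝓛(w)` (Björner–Brenti Prop. 3.1.3; Iwahori–Matsumoto Cor. 1.11; Humphreys §4.4 (c))

A. Björner, F. Brenti, *Combinatorics of Coxeter Groups* (2005) [BjornerBrenti2005] (held, chunk p0057 = book p. 66), §3.1: «**Proposition 3.1.3**
Let `u, w ∈ W`. Then `u ≤_R w ⟺ T_L(u) ⊆ T_L(w)`»; §1.4 (1.19), (1.22): `T_L(w) = {t ∈ T : ℓ(tw) < ℓ(w)}`, `D_L(w) = T_L(w) ∩ S`, `D_R(w) = T_R(w) ∩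
S`.  N. Iwahori, H. Matsumoto [IwahoriMatsumoto1965] (held `paper:doi-10-1007-bf02684396`, p0010 = p. 245), COROLLARY 1.11: «Let `σ ∈ D′W` and `i`
be an integer with `0 ≤ i ≤ l`. Then there exists a reduced expression of `σ` starting with `w_i` (resp. ending at `w_i`) if and only if `P_i ∈
Δ(σ)` (resp. `P_i ∈ Δ(σ⁻¹)`)».  J. E. Humphreys, *Reflection Groups and Coxeter Groups* (1990) [Humphreys1990], §4.4 PROPOSITION (c): «`n(ws) =
n(w) - 1` if `H_s ∈ 𝓛(w⁻¹)`, and `n(ws) = n(w) + 1` otherwise.»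

THIS FILE (lane `lit-hodgefound`, prover seat p40, generation 46, row g46-#14; THEOREMS ONLY — no definition, instance, notation or named fact; net
debt 0) restates rows g46-#6 (weak order and descents by floor data) in the HYPERPLANE-SET language of rows g46-#7 ∕ #9 ∕ #11: `𝓛(w) = {H ⊆ V | ∃ α
m, H = H_{α,m} ∧ Xor (m ≤ k∘_α) (m ≤ d_α)}` for `wA∘ = alcove d`; a wall of `A∘` is `H_s = H_{α_s,m_s}` for `s = s_{α_s,m_s} ∈ S_a` (hypothesis `hs :
↑(wallReflection b η x) = affineReflection P α_s m_s`, supplied by rows g45-#1 ∕ g46-#6 `wallReflection_some_eq_mk`, `wallReflection_none_eq_mk`).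

* §1 ★★★ **`weakRightLE_iff_setOf_separating_subset`** (PROPOSITION 3.1.3 WITH SETS OF HYPERPLANES: `u ≤_R w ⟺ 𝓛(u) ⊆ 𝓛(w)`).
* §2 ★★★ **`isLeftDescent_iff_affineHyperplane_mem`** (`s ∈ D_L(w) ⟺ H_s ∈ 𝓛(w)`: the left descents of `w` are the WALLS OF `A∘` separating `A∘` from
  `wA∘` — «starting with `w_i` ⟺ `P_i ∈ Δ(σ)`»).
* §3 ★★★ **`isRightDescent_iff_image_affineHyperplane_mem`** (`s ∈ D_R(w) ⟺ w(H_s) ∈ 𝓛(w)`: the right descents of `w` are the WALLS OF THE ALCOVE `wA∘`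
  (the `w`-images of the walls of `A∘`) separating `wA∘` from `A∘` — «ending at `w_i` ⟺ `P_i ∈ Δ(σ⁻¹)`», `Δ(σ⁻¹) = σ⁻¹Δ(σ)` (row g46-#11), Humphreys'
  «`H_s ∈ 𝓛(w⁻¹)`»), ★★ **`isRightDescent_iff_affineHyperplane_mem_inv`** (`⟺ H_s ∈ 𝓛(w⁻¹)`, as printed).

BY NAME, nothing restated: rows g46-#6 (`weakRightLE_iff_forall_xor_imp`), g46-#2 (`length_affineReflection_mul_lt_iff`), g46-#9
(`affineHyperplane_mem_setOf_separating_iff`), g46-#11 (`image_image_setOf_separating_inv`), g45-#1 (`wallReflection`, `isPreCoxeterSystem_affineWeylGroup`),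
g44-#6 ∕ #7 (`alcove`, `fundamentalAlcove_eq_alcove`, `smul_sum_filter_isPos_mem_fundamentalAlcove`), p13 (`WeakRightLE`, `length_simple_eq`), Mathlib
(`CoxeterSystem.IsLeftDescent`, `IsRightDescent`, `isRightDescent_inv_iff`).

## Scope caveats

`D_L(w)`, `D_R(w)` are treated one generator at a time (no descent SET is formed). Finite reduced crystallographic root systems over an ordered field of
characteristic zero; `η` with `hη` (highest coroot).

## References

* [BjornerBrenti2005] A. Björner, F. Brenti, *Combinatorics of Coxeter Groups*, GTM 231, Springer (2005), §3.1 Proposition 3.1.3 (p. 66), §1.4 (1.19),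
  (1.22).
* [IwahoriMatsumoto1965] N. Iwahori, H. Matsumoto, Publ. Math. IHÉS 25 (1965) 5–48, §1.5 Corollary 1.11 (p. 245).
* [Humphreys1990] J. E. Humphreys, *Reflection Groups and Coxeter Groups*, CUP (1990), §4.4 Proposition (c) (p. 91).
-/

noncomputable section

open Module Set Function
open Literature.GroupTheory.Coxeter Literature.GroupTheory.Coxeter.PreCoxeterSystem

namespace Literature.LinearAlgebra.RootSystem

namespace Base

variable {ι K M N : Type*} [Field K] [LinearOrder K] [IsStrictOrderedRing K] [AddCommGroup M] [Module K M]
  [AddCommGroup N] [Module K N] [Fintype ι] [DecidableEq ι]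
  {P : RootPairing ι K M N} [CharZero K] [P.IsCrystallographic] [P.IsReduced] (b : P.Base)

variable [Nonempty ι] [DecidablePred b.IsPos] {η : ι}
  (hη : ∀ k, P.coroot η - P.coroot k ∈ AddSubmonoid.closure (P.coroot '' (b.support : Set ι)))
  {M' : CoxeterMatrix (Option b.support)} (cs : CoxeterSystem M' (affineWeylGroup P)) (hcs : ∀ o, cs.simple o = wallReflection b η o)

include hη hcs

/-! ## §1 Proposition 3.1.3 with sets of hyperplanes -/

section WeakOrder

/-- ★★★ **PROPOSITION 3.1.3 WITH SETS OF HYPERPLANES: `u ≤_R w ⟺ 𝓛(u) ⊆ 𝓛(w)`** (`uA∘ = alcove a`, `wA∘ = alcove d`; `𝓛(·) ⊆ Set V` the separating sets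
of row g46-#7; the reflections in the hyperplanes of `𝓛(w)` form `T_L(w)`, row g46-#2). [cite: BjornerBrenti2005, §3.1 Proposition 3.1.3 ("u ≤_R w ⟺ T_L(u) ⊆ T_L(w)")] [cite: Humphreys1990, §4.5 Theorem] -/
theorem weakRightLE_iff_setOf_separating_subset (u w : affineWeylGroup P) {a d : ι → ℤ}
    (ha : (u : M ≃ᵃ[K] M) '' {x : M | ∀ i, b.IsPos i → 0 < P.coroot' i x ∧ P.coroot' i x < 1} = alcove P a)
    (hd : (w : M ≃ᵃ[K] M) '' {x : M | ∀ i, b.IsPos i → 0 < P.coroot' i x ∧ P.coroot' i x < 1} = alcove P d) :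
    WeakRightLE cs u w ↔
      {H : Set M | ∃ (i : ι) (m : ℤ), H = affineHyperplane P i (m : K) ∧ Xor (m ≤ (if b.IsPos i then (0 : ℤ) else -1)) (m ≤ a i)} ⊆
        {H : Set M | ∃ (i : ι) (m : ℤ), H = affineHyperplane P i (m : K) ∧ Xor (m ≤ (if b.IsPos i then (0 : ℤ) else -1)) (m ≤ d i)} := by
  obtain ⟨x₀, hx₀⟩ : {x : M | ∀ i, b.IsPos i → 0 < P.coroot' i x ∧ P.coroot' i x < 1}.Nonempty :=
    ⟨_, smul_sum_filter_isPos_mem_fundamentalAlcove b hη⟩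
  have hA : {x : M | ∀ i, b.IsPos i → 0 < P.coroot' i x ∧ P.coroot' i x < 1} = alcove P (fun i ↦ if b.IsPos i then (0 : ℤ) else -1) :=
    fundamentalAlcove_eq_alcove b
  have hne₀ : (alcove P (fun i ↦ if b.IsPos i then (0 : ℤ) else -1)).Nonempty := ⟨x₀, hA ▸ hx₀⟩
  have hned : (alcove P d).Nonempty := ⟨_, hd ▸ mem_image_of_mem _ hx₀⟩
  rw [weakRightLE_iff_forall_xor_imp b cs hcs hη u w ha hd]
  constructor
  · rintro h H ⟨i, m, rfl, hx⟩
    exact ⟨i, m, rfl, h i m hx⟩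
  · intro h i m hx
    exact (affineHyperplane_mem_setOf_separating_iff hne₀ hned i m).mp (h ⟨i, m, rfl, hx⟩)

end WeakOrder

/-! ## §2 Left descents: the walls of `A∘` in `𝓛(w)` -/

section Left

variable (x : Option b.support) {sa : ι} {ms : ℤ}
  (hs : ((wallReflection b η x : affineWeylGroup P) : M ≃ᵃ[K] M) = affineReflection P sa ms)

include hs

/-- ★★★ **`s ∈ D_L(w) ⟺ H_s ∈ 𝓛(w)`: THE LEFT DESCENTS OF `w` ARE THE WALLS OF `A∘` THAT SEPARATE `A∘` FROM `wA∘`** (`s = s_{α_s,m_s} ∈ S_a`, `H_s =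
H_{α_s,m_s}`, `wA∘ = alcove d`). [cite: IwahoriMatsumoto1965, Cor. 1.11 ("there exists a reduced expression of σ starting with w_i … if and only if P_i ∈ Δ(σ)")] [cite: BjornerBrenti2005, §1.4 (1.22) ("D_L(w) = T_L(w) ∩ S")] [cite: Humphreys1990, §4.5 Theorem (a)] -/
theorem isLeftDescent_iff_affineHyperplane_mem [P.IsRootSystem] (w : affineWeylGroup P) {d : ι → ℤ}
    (hd : (w : M ≃ᵃ[K] M) '' {x : M | ∀ i, b.IsPos i → 0 < P.coroot' i x ∧ P.coroot' i x < 1} = alcove P d) :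
    cs.IsLeftDescent w x ↔
      affineHyperplane P sa (ms : K) ∈
        {H : Set M | ∃ (i : ι) (m : ℤ), H = affineHyperplane P i (m : K) ∧ Xor (m ≤ (if b.IsPos i then (0 : ℤ) else -1)) (m ≤ d i)} := by
  obtain ⟨x₀, hx₀⟩ : {x : M | ∀ i, b.IsPos i → 0 < P.coroot' i x ∧ P.coroot' i x < 1}.Nonempty :=
    ⟨_, smul_sum_filter_isPos_mem_fundamentalAlcove b hη⟩
  have hA : {x : M | ∀ i, b.IsPos i → 0 < P.coroot' i x ∧ P.coroot' i x < 1} = alcove P (fun i ↦ if b.IsPos i then (0 : ℤ) else -1) :=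
    fundamentalAlcove_eq_alcove b
  have hne₀ : (alcove P (fun i ↦ if b.IsPos i then (0 : ℤ) else -1)).Nonempty := ⟨x₀, hA ▸ hx₀⟩
  have hned : (alcove P d).Nonempty := ⟨_, hd ▸ mem_image_of_mem _ hx₀⟩
  have h1 : cs.simple = wallReflection b η := funext hcs
  have hs' : wallReflection b η x = ⟨affineReflection P sa ms, affineReflection_mem_affineWeylGroup P sa ms⟩ := Subtype.ext hs
  rw [affineHyperplane_mem_setOf_separating_iff hne₀ hned, CoxeterSystem.IsLeftDescent, hcs, hs', ← length_simple_eq cs,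
    ← length_simple_eq cs, h1]
  exact length_affineReflection_mul_lt_iff b hη w hd sa ms

end Left

/-! ## §3 Right descents: the walls of `wA∘` in `𝓛(w)` -/

section Right

variable (x : Option b.support) {sa : ι} {ms : ℤ}
  (hs : ((wallReflection b η x : affineWeylGroup P) : M ≃ᵃ[K] M) = affineReflection P sa ms)

include hs

/-- ★★ **`s ∈ D_R(w) ⟺ H_s ∈ 𝓛(w⁻¹)`** («ending at `w_i` … `P_i ∈ Δ(σ⁻¹)`», «`n(ws) = n(w) - 1` if `H_s ∈ 𝓛(w⁻¹)`»; `w⁻¹A∘ = alcove d′`).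
[cite: IwahoriMatsumoto1965, Cor. 1.11 ("resp. ending at w_i … resp. P_i ∈ Δ(σ⁻¹)")] [cite: Humphreys1990, §4.4 Proposition (c) ("n(ws) = n(w) − 1 if H_s ∈ 𝓛(w⁻¹)")] -/
theorem isRightDescent_iff_affineHyperplane_mem_inv [P.IsRootSystem] (w : affineWeylGroup P) {d' : ι → ℤ}
    (hd' : ((w⁻¹ : affineWeylGroup P) : M ≃ᵃ[K] M) '' {x : M | ∀ i, b.IsPos i → 0 < P.coroot' i x ∧ P.coroot' i x < 1} = alcove P d') :
    cs.IsRightDescent w x ↔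
      affineHyperplane P sa (ms : K) ∈
        {H : Set M | ∃ (i : ι) (m : ℤ), H = affineHyperplane P i (m : K) ∧ Xor (m ≤ (if b.IsPos i then (0 : ℤ) else -1)) (m ≤ d' i)} := by
  rw [← inv_inv w, CoxeterSystem.isRightDescent_inv_iff]
  exact isLeftDescent_iff_affineHyperplane_mem b hη cs hcs x hs w⁻¹ hd'

/-- ★★★ **`s ∈ D_R(w) ⟺ w(H_s) ∈ 𝓛(w)`: THE RIGHT DESCENTS OF `w` ARE THE WALLS OF THE ALCOVE `wA∘` THAT SEPARATE IT FROM `A∘`** — the walls of `wA∘` are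
the `w`-images `w(H_s)` of the walls of `A∘`, and `H_s ∈ 𝓛(w⁻¹) = w⁻¹𝓛(w)` (row g46-#11) iff `w(H_s) ∈ 𝓛(w)`; `wA∘ = alcove d`.
[cite: IwahoriMatsumoto1965, Cor. 1.11 ("resp. P_i ∈ Δ(σ⁻¹)")] [cite: Humphreys1990, §4.4 Proposition (c) and §4.3 ("walls")] [cite: BjornerBrenti2005, §1.4 (1.22) ("D_R(w) = T_R(w) ∩ S")] -/
theorem isRightDescent_iff_image_affineHyperplane_mem [P.IsRootSystem] (w : affineWeylGroup P) {d : ι → ℤ}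
    (hd : (w : M ≃ᵃ[K] M) '' {x : M | ∀ i, b.IsPos i → 0 < P.coroot' i x ∧ P.coroot' i x < 1} = alcove P d) :
    cs.IsRightDescent w x ↔
      (w : M ≃ᵃ[K] M) '' affineHyperplane P sa (ms : K) ∈
        {H : Set M | ∃ (i : ι) (m : ℤ), H = affineHyperplane P i (m : K) ∧ Xor (m ≤ (if b.IsPos i then (0 : ℤ) else -1)) (m ≤ d i)} := by
  obtain ⟨d', hd'⟩ := exists_image_eq_alcove_of_mem_affineWeylGroup (w⁻¹).2 (fun i ↦ if b.IsPos i then (0 : ℤ) else -1)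
  rw [← fundamentalAlcove_eq_alcove b] at hd'
  rw [isRightDescent_iff_affineHyperplane_mem_inv b hη cs hcs x hs w hd',
    ← image_image_setOf_separating_inv b hη (affineWeylGroup_le_extendedAffineWeylGroup P w.2) hd
      (by rw [← Subgroup.coe_inv]; exact hd')]
  constructor
  · rintro ⟨H, hH, hHs⟩
    have : (w : M ≃ᵃ[K] M) '' affineHyperplane P sa (ms : K) = H := by
      rw [← hHs, ← image_comp, ← AffineEquiv.coe_mul, mul_inv_cancel, AffineEquiv.coe_one, image_id]
    rw [this]; exact hH
  · intro h
    refine ⟨_, h, ?_⟩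
    show ⇑(w : M ≃ᵃ[K] M)⁻¹ '' ((w : M ≃ᵃ[K] M) '' affineHyperplane P sa (ms : K)) = affineHyperplane P sa (ms : K)
    rw [← image_comp, ← AffineEquiv.coe_mul, inv_mul_cancel, AffineEquiv.coe_one, image_id]

end Right

end Base

end Literature.LinearAlgebra.RootSystem
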